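import Literature.MathematicalPhysics.QuantumLattice.LiebWuMagnetizationMonotone
import HarnessLib

/-!
# Lieb–Wu 2003, Lemma 4 at fixed `B < ∞`: the source of `σ_{S,R} - σ_{S,P}` is positive

Family `hubbard`. Lieb–Wu, Physica A 321 (2003) 1, §5, LEMMA 4 (Monotonicity in `Q`) "for fixed `B ≤ ∞`".
The tree proves Lemma 4 / Theorem 3 at `B = ∞` (`LiebWuSourcePositivity`, `LiebWuFillingMonotone`) by a
derivative-free form of the printed argument: for cutoffs `0 < P < R ≤ π`, subtracting the fixed-point
equations (S) gives `δ := σ_R - σ_P = s + Ŵ_P δ` with source `s = (ξ_R - ξ_P) + (Ŵ_R - Ŵ_P)σ_R > 0`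
(`liebWu_source_pos`, input: Lemma 5), and positivity of `(1 - Ŵ_P)⁻¹`. This file supplies the same two
ingredients for a finite rapidity range `S` (`σ_{S,Q} = liebWuSigmaAtS U Q S`, `Ŵ_{S,Q} = liebWuWS U Q S`):

* `liebWuWS_sub`, `nonneg_of_sub_liebWuWS_nonneg`: linearity and **positivity of `(1 - Ŵ_{S,P})⁻¹`**
  (`δ - Ŵ_{S,P}δ ≥ 0 ⇒ δ ≥ 0`; `∫Ŵ_{S,P}δ⁻ ≤ ½∫δ⁻`);
* `liebWuSigmaAtS_source_pos`: **the source `(ξ_R - ξ_P) + (Ŵ_R - Ŵ_P)(1_S σ_{S,R})` is positive.** The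
  `Q`-dependence of `Ŵ_{S,Q}h = Ŵ_Q(1_S h) + u ∗ (1_{Sᶜ}h)` sits in `Ŵ_Q` alone, so the source has the `B = ∞`
  shape with `h = 1_S σ_{S,R}`; `liebWu_source_pos` wants `h ≤ σ₀` pointwise, which fails for `B < ∞`
  (Lemma 1: `σ_{S,R} ≥ σ_R`), but only `h ∗ K ≤ σ₀ ∗ K` is used there, and
  `(1_S σ_{S,R}) ∗ K = G_{S,R} ≤ G_{ℝ,R} = σ_R ∗ K` by LEMMA 2 (`liebWuG_mono_set`) with `σ_R ≤ σ₀`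
  (`liebWuSigmaAt_le_liebWuSigma0`). Concretely: if `sin P ≤ sin R` the `Ŵ`-part is `≥ 0` and
  `ξ_R - ξ_P > 0` (`liebWu_source_pos` with `h = 0`); if `sin R < sin P` the `Ŵ`-part is
  `-½∫_{a_R<|y|≤a_P} G_{S,R} r ≥ -½∫ (σ_R ∗ K) r`, i.e. the source dominates the `B = ∞`-type source with
  `h = σ_R`, positive by `liebWu_source_pos`.

Lemma 4 and Theorem 3 at fixed `B` follow in `LiebWuFiniteBCutoffMonotone`. No definition, no named fact.

## References

* E. H. Lieb, F. Y. Wu, Physica A 321 (2003) 1–27 = arXiv:cond-mat/0207529, §5, Lemma 4 and its proof,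
  proofs of Lemmas 2–3 and Theorem 1; §6 Lemma 5 (key `LiebWuPhysicaA2003`).
-/

noncomputable section

open MeasureTheory Set Real Filter intervalIntegral
open Literature.Analysis.SpecialFunctions Literature.Analysis.FunctionSpaces
open scoped Convolution

namespace Literature.MathematicalPhysics.QuantumLattice

namespace LiebWuCutoffS

variable {f g : ℝ → ℝ} {B : ℝ}

/-- `x ↦ ∫ f(t) g(x - t) dt` is continuous for `f ∈ L¹`, `g` bounded continuous. [folklore] -/
private theorem continuous_conv₇ (hf : Integrable f) (hgc : Continuous g) (hgB : ∀ y, |g y| ≤ B) :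
    Continuous fun x => ∫ t, f t * g (x - t) := by
  have h : (fun x => ∫ t, f t * g (x - t)) = f ⋆[ContinuousLinearMap.mul ℝ ℝ, volume] g := by
    funext x; rw [convolution_def]; simp only [ContinuousLinearMap.mul_apply']
  rw [h]
  refine BddAbove.continuous_convolution_right_of_integrable (L := ContinuousLinearMap.mul ℝ ℝ)
    ⟨B, ?_⟩ hf hgc
  rintro _ ⟨y, rfl⟩
  exact (Real.norm_eq_abs _).trans_le (hgB y)

end LiebWuCutoffS

open LiebWuCutoffS

variable {U Q P R : ℝ} {S : Set ℝ} {h h₁ h₂ : ℝ → ℝ}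

section Positivity

/-- `Ŵ_{S,Q} h = Ŵ_Q (1_S h) + Û(1 - B̂) h`. [cite: LiebWuPhysicaA2003, §5, eqs. (S), (W)] -/
theorem liebWuWS_eq_W_add_T (U Q : ℝ) (S : Set ℝ) (h : ℝ → ℝ) (x : ℝ) :
    liebWuWS U Q S h x = liebWuW U Q (S.indicator h) x + liebWuT U S h x := rfl

/-- `Ŵ_{S,Q}` is linear: `Ŵ h₁ - Ŵ h₂ = Ŵ (h₁ - h₂)` for integrable `h₁, h₂`. [cite: LiebWuPhysicaA2003, §5, eq. (W)] -/
theorem liebWuWS_sub (hU : 0 < U) (hS : MeasurableSet S) (h₁i : Integrable h₁) (h₂i : Integrable h₂)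
    (x : ℝ) : liebWuWS U Q S h₁ x - liebWuWS U Q S h₂ x = liebWuWS U Q S (fun t => h₁ t - h₂ t) x := by
  have hind : S.indicator (fun t => h₁ t - h₂ t) = fun t => S.indicator h₁ t - S.indicator h₂ t := by
    funext t
    by_cases ht : t ∈ S
    · simp only [indicator_of_mem ht]
    · simp only [indicator_of_notMem ht, sub_zero]
  have hT : liebWuT U S h₁ x = liebWuT U S (fun t => h₁ t - h₂ t) x + liebWuT U S h₂ x := by
    have h := liebWuT_add hU hS (h₁ := fun t => h₁ t - h₂ t) (h₂ := h₂) (h₁i.sub h₂i) h₂i x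
    have he : (fun t => h₁ t - h₂ t + h₂ t) = h₁ := funext fun t => sub_add_cancel _ _
    rw [he] at h
    exact h
  rw [liebWuWS_eq_W_add_T, liebWuWS_eq_W_add_T, liebWuWS_eq_W_add_T, hind,
    ← liebWuW_sub hU Q (h₁i.indicator hS) (h₂i.indicator hS), hT]
  ring

/-- **Positivity of `(1 - Ŵ_{S,Q})⁻¹`:** if `δ` is continuous and integrable and `δ - Ŵ_{S,Q} δ ≥ 0`, then
`δ ≥ 0` (`δ⁻ ≤ Ŵ_{S,Q} δ⁻` and `∫ Ŵ_{S,Q} δ⁻ ≤ ½ ∫ δ⁻` force `δ⁻ = 0`).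
[cite: LiebWuPhysicaA2003, §5, proofs of Theorem 1 and Lemma 4] -/
theorem nonneg_of_sub_liebWuWS_nonneg (hU : 0 < U) (hS : MeasurableSet S) (Q : ℝ) {δ : ℝ → ℝ}
    (hδc : Continuous δ) (hδi : Integrable δ) (hs : ∀ x, 0 ≤ δ x - liebWuWS U Q S δ x) (x : ℝ) :
    0 ≤ δ x := by
  have hpi : Integrable fun t => max (δ t) 0 := hδi.pos_part
  have hmi : Integrable fun t => max (-δ t) 0 := hδi.neg_part
  have hp0 : ∀ t, 0 ≤ max (δ t) 0 := fun t => le_max_right _ _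
  have hm0 : ∀ t, 0 ≤ max (-δ t) 0 := fun t => le_max_right _ _
  have hmc : Continuous fun t => max (-δ t) 0 := hδc.neg.max continuous_const
  obtain ⟨-, hWp0, -, -, -⟩ := liebWuWS_props (Q := Q) hU hS hpi hp0
  obtain ⟨-, hWm0, hWmi, hWmint, -⟩ := liebWuWS_props (Q := Q) hU hS hmi hm0
  have hδpm : (fun t => max (δ t) 0 - max (-δ t) 0) = δ :=
    funext fun t => max_zero_sub_max_neg_zero_eq_self (δ t)
  have hsplit : ∀ y, liebWuWS U Q S δ y =
      liebWuWS U Q S (fun t => max (δ t) 0) y - liebWuWS U Q S (fun t => max (-δ t) 0) y := by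
    intro y
    rw [liebWuWS_sub hU hS hpi hmi, hδpm]
  have hle : ∀ y, max (-δ y) 0 ≤ liebWuWS U Q S (fun t => max (-δ t) 0) y := fun y =>
    max_le (by linarith [hs y, hsplit y, hWp0 y]) (hWm0 y)
  have hI : ∫ t, max (-δ t) 0 = 0 := by
    have h1 := integral_mono hmi hWmi hle
    have h2 : 0 ≤ ∫ t, max (-δ t) 0 := integral_nonneg hm0
    linarith
  have hae : (fun t => max (-δ t) 0) =ᵐ[volume] (fun _ => (0 : ℝ)) :=
    (integral_eq_zero_iff_of_nonneg (fun t => hm0 t) hmi).1 hI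
  have hzero := congr_fun ((hmc.ae_eq_iff_eq volume continuous_const).1 hae) x
  have hx : max (-δ x) 0 = 0 := hzero
  linarith [le_max_left (-δ x) 0]

end Positivity

section Source

/-- `Ŵ_R g - Ŵ_P g = ½ (∫_{-a_R}^{-a_P} φ - ∫_{a_R}^{a_P} φ)` with `φ(y) = (g ∗ K)(y) r(x - y)`, `a = sin`.
[cite: LiebWuPhysicaA2003, §5, eq. (W)] -/
theorem liebWuW_sub_liebWuW_eq (hP : 0 ≤ P) (hPπ : P ≤ π) (hR : 0 ≤ R) (hRπ : R ≤ π) (U : ℝ)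
    {g : ℝ → ℝ} (x : ℝ) (hφi : ∀ a b, IntervalIntegrable
      (fun y => (∫ t, g t * cauchyDensity (U / 4) (y - t)) * sechKernel (U / 4) (x - y)) volume a b) :
    liebWuW U R g x - liebWuW U P g x = 1 / 2 *
      ((∫ y in -Real.sin R..-Real.sin P,
          (∫ t, g t * cauchyDensity (U / 4) (y - t)) * sechKernel (U / 4) (x - y)) -
        ∫ y in Real.sin R..Real.sin P,
          (∫ t, g t * cauchyDensity (U / 4) (y - t)) * sechKernel (U / 4) (x - y)) := by
  rw [liebWuW_eq_intervalIntegral hR hRπ, liebWuW_eq_intervalIntegral hP hPπ, ← mul_sub,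
    intervalIntegral.integral_interval_sub_interval_comm (hφi _ _) (hφi _ _) (hφi _ _)]

/-- `(g ∗ K) · r(x - ·)` is continuous and nonnegative for `0 ≤ g ∈ L¹`. [folklore] -/
private theorem phi_props₇ (hU : 0 < U) {g : ℝ → ℝ} (hgi : Integrable g) (hg0 : ∀ t, 0 ≤ g t) (x : ℝ) :
    Continuous (fun y => (∫ t, g t * cauchyDensity (U / 4) (y - t)) * sechKernel (U / 4) (x - y)) ∧
      ∀ y, 0 ≤ (∫ t, g t * cauchyDensity (U / 4) (y - t)) * sechKernel (U / 4) (x - y) := by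
  have hc : 0 < U / 4 := by positivity
  have hKB : ∀ z, |cauchyDensity (U / 4) z| ≤ 1 / (π * (U / 4)) := fun z => by
    rw [abs_of_pos (cauchyDensity_pos hc z)]; exact cauchyDensity_le hc z
  exact ⟨(continuous_conv₇ hgi (continuous_cauchyDensity hc) hKB).mul
      ((continuous_sechKernel hc).comp (continuous_const.sub continuous_id)),
    fun y => mul_nonneg (integral_nonneg fun t => mul_nonneg (hg0 t) (cauchyDensity_pos hc _).le)
      (sechKernel_pos hc _).le⟩

/-- Case `sin P ≤ sin R` ("`Â` has a kernel that increases with `a`"): `Ŵ_R g - Ŵ_P g ≥ 0` for `g ≥ 0`.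
[cite: LiebWuPhysicaA2003, §5, proof of Lemma 4] -/
theorem liebWuW_sub_liebWuW_nonneg (hU : 0 < U) (hP : 0 ≤ P) (hPπ : P ≤ π) (hR : 0 ≤ R) (hRπ : R ≤ π)
    (hs : Real.sin P ≤ Real.sin R) {g : ℝ → ℝ} (hgi : Integrable g) (hg0 : ∀ t, 0 ≤ g t) (x : ℝ) :
    0 ≤ liebWuW U R g x - liebWuW U P g x := by
  obtain ⟨hφc, hφ0⟩ := phi_props₇ hU hgi hg0 x
  rw [liebWuW_sub_liebWuW_eq hP hPπ hR hRπ U x fun a b => hφc.intervalIntegrable _ _]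
  have h1 : 0 ≤ ∫ y in -Real.sin R..-Real.sin P,
      (∫ t, g t * cauchyDensity (U / 4) (y - t)) * sechKernel (U / 4) (x - y) :=
    intervalIntegral.integral_nonneg (by linarith) fun y _ => hφ0 y
  have h2 : ∫ y in Real.sin R..Real.sin P,
      (∫ t, g t * cauchyDensity (U / 4) (y - t)) * sechKernel (U / 4) (x - y) ≤ 0 := by
    rw [intervalIntegral.integral_symm]
    exact neg_nonpos.2 (intervalIntegral.integral_nonneg hs fun y _ => hφ0 y)
  nlinarith

/-- Case `sin R ≤ sin P`: `Ŵ_R g - Ŵ_P g = -½ ∫_{a_R<|y|≤a_P} (g ∗ K) r` is ANTITONE in `g ∗ K`.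
[cite: LiebWuPhysicaA2003, §5, proof of Lemma 4] -/
theorem liebWuW_sub_liebWuW_anti (hU : 0 < U) (hP : 0 ≤ P) (hPπ : P ≤ π) (hR : 0 ≤ R) (hRπ : R ≤ π)
    (hs : Real.sin R ≤ Real.sin P) {g₁ g₂ : ℝ → ℝ} (h₁i : Integrable g₁) (h₁0 : ∀ t, 0 ≤ g₁ t)
    (h₂i : Integrable g₂) (h₂0 : ∀ t, 0 ≤ g₂ t)
    (hle : ∀ y, ∫ t, g₁ t * cauchyDensity (U / 4) (y - t) ≤ ∫ t, g₂ t * cauchyDensity (U / 4) (y - t))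
    (x : ℝ) : liebWuW U R g₂ x - liebWuW U P g₂ x ≤ liebWuW U R g₁ x - liebWuW U P g₁ x := by
  have hc : 0 < U / 4 := by positivity
  obtain ⟨hφ₁c, -⟩ := phi_props₇ hU h₁i h₁0 x
  obtain ⟨hφ₂c, -⟩ := phi_props₇ hU h₂i h₂0 x
  have hmono : ∀ y, (∫ t, g₁ t * cauchyDensity (U / 4) (y - t)) * sechKernel (U / 4) (x - y) ≤
      (∫ t, g₂ t * cauchyDensity (U / 4) (y - t)) * sechKernel (U / 4) (x - y) :=
    fun y => mul_le_mul_of_nonneg_right (hle y) (sechKernel_pos hc _).le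
  rw [liebWuW_sub_liebWuW_eq hP hPπ hR hRπ U x fun a b => hφ₁c.intervalIntegrable _ _,
    liebWuW_sub_liebWuW_eq hP hPπ hR hRπ U x fun a b => hφ₂c.intervalIntegrable _ _,
    intervalIntegral.integral_symm (-Real.sin P) (-Real.sin R), intervalIntegral.integral_symm (-Real.sin P) (-Real.sin R)]
  have hA := intervalIntegral.integral_mono_on (μ := volume) (by linarith : -Real.sin P ≤ -Real.sin R)
    (hφ₁c.intervalIntegrable _ _) (hφ₂c.intervalIntegrable _ _) fun y _ => hmono y
  have hB := intervalIntegral.integral_mono_on (μ := volume) hs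
    (hφ₁c.intervalIntegrable _ _) (hφ₂c.intervalIntegrable _ _) fun y _ => hmono y
  linarith

/-- `Ŵ_Q 0 = 0`. [cite: LiebWuPhysicaA2003, §5, eq. (W)] -/
theorem liebWuW_zero (U Q x : ℝ) : liebWuW U Q 0 x = 0 := by
  simp [liebWuW]

/-- `G_{ℝ,R} = σ_R ∗ K`. [cite: LiebWuPhysicaA2003, §5, eq. (feqn)] -/
theorem liebWuG_univ (U Q y : ℝ) :
    liebWuG U Q univ y = ∫ t, liebWuSigmaAt U Q t * cauchyDensity (U / 4) (y - t) := by
  simp [liebWuG, liebWuSigmaAtS_univ]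

/-- **The source of `σ_{S,R} - σ_{S,P}` is positive** (`0 < P < R ≤ π`, any measurable range `S`):
`(ξ_R - ξ_P)(x) + (Ŵ_R - Ŵ_P)(1_S σ_{S,R})(x) > 0`. [cite: LiebWuPhysicaA2003, §5, proof of Lemma 4] -/
theorem liebWuSigmaAtS_source_pos (hU : 0 < U) (hP : 0 < P) (hPR : P < R) (hRπ : R ≤ π)
    (hS : MeasurableSet S) (x : ℝ) :
    0 < liebWuXi U R x - liebWuXi U P x +
      (liebWuW U R (S.indicator (liebWuSigmaAtS U R S)) x -
        liebWuW U P (S.indicator (liebWuSigmaAtS U R S)) x) := by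
  have hR0 : 0 < R := hP.trans hPR
  have hPπ : P ≤ π := hPR.le.trans hRπ
  have hσi : Integrable (S.indicator (liebWuSigmaAtS U R S)) := (integrable_liebWuSigmaAtS hU hR0 hS).indicator hS
  have hσ0 : ∀ t, 0 ≤ S.indicator (liebWuSigmaAtS U R S) t := fun t =>
    indicator_nonneg (fun s _ => (liebWuSigmaAtS_pos hU hR0 hS s).le) _
  have hσ00 : ∀ t, (0 : ℝ) ≤ liebWuSigma0 U t := fun t => (liebWuSigma0_pos hU t).le
  rcases le_or_gt (Real.sin P) (Real.sin R) with hs | hs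
  · -- `a_P ≤ a_R`: `ξ_R - ξ_P > 0` and the `Ŵ`-part is `≥ 0`
    have h0 := liebWu_source_pos (h := 0) hU hP hPR hRπ (integrable_zero ℝ ℝ volume) (fun _ => le_rfl) hσ00 x
    rw [liebWuW_zero, liebWuW_zero, sub_zero, add_zero] at h0
    linarith [liebWuW_sub_liebWuW_nonneg hU hP.le hPπ hR0.le hRπ hs hσi hσ0 x]
  · -- `a_R < a_P`: dominate by the `B = ∞` source with `h = σ_R ≤ σ₀`
    have hsRi := integrable_liebWuSigmaAt hU hR0
    have hsR0 : ∀ t, 0 ≤ liebWuSigmaAt U R t := fun t => (liebWuSigmaAt_pos hU hR0 t).le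
    have h1 := liebWu_source_pos hU hP hPR hRπ hsRi hsR0 (liebWuSigmaAt_le_liebWuSigma0 hU hR0 hRπ) x
    have hle : ∀ y, ∫ t, S.indicator (liebWuSigmaAtS U R S) t * cauchyDensity (U / 4) (y - t) ≤
        ∫ t, liebWuSigmaAt U R t * cauchyDensity (U / 4) (y - t) := fun y => by
      rw [← liebWuG_univ U R y]
      exact liebWuG_mono_set hU hR0 hS MeasurableSet.univ (subset_univ _) y
    linarith [liebWuW_sub_liebWuW_anti hU hP.le hPπ hR0.le hRπ hs.le hσi hσ0 hsRi hsR0 hle x]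

end Source

end Literature.MathematicalPhysics.QuantumLattice

end
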